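import Literature.IUT.LogVolume.GenuineLogThetaPerImageExactVolume
import Literature.IUT.LogVolume.TensorPacketOrbitStable
import Literature.IUT.LogVolume.TensorPacketHullVolume
import HarnessLib

/-!
# `−|log(Θ)|_(P)` is MONOTONE in the (Ind2)-group: reading (P) over a SUB-indeterminacy `H ≤ Aut_{ℚ_p}(V : log_p(R_I^×))`
# lies between the bare pilot volume and the container reading, and EQUALS the bare volume when `H` stabilises the Θ-regions
# (Dupuy–Hilado §3.9, §4.9, §4.12; [IUTchIII] Cor. 3.12 Step (x); [IUTchII] Ex. 1.8 (iv))

Proof-only file of the abc-iut cell (WAVE-3 discharge seat abc-iut-c312-d1, gen 10; sequel to `TensorPacketOrbitStable` (p500042) /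
`LDHGenuinePerImageZeroGain` (p500550), row «C:PERIMAGE-IND2-SEMILINEAR»; the kernel form of referee finding **F-B28-1**'s clause «the
container reading is ANTI-conservative for per-image readings»). TAKES NO SIDE on [IUTchIII] Cor. 3.12.

SETTING. The real prime packet `Q = realPrimePacketWith p 𝔽 c` (any shell normalisation `c`; abc-iut-c312-3) over a family of genuine
completions, a `p`-local theta idele `t`, and in each degree `j = i+1 ≤ ℓ⋆` and collection `v⃗ = e` the Θ-region
`M = O_𝕃(−P_Θ)_{v⃗} = ι_j(t_{i,v_j})·(R_I)^∼`. The cell's per-image number `Q.negLogThetaPerImageAt ℓ⋆ t` is `ln ν̄_{𝕃_p}` of the hull of the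
orbit of `M` under the FULL container `Q.G₂ = indTwo = Aut_{ℚ_p}(V : log_p(R_I^×))`. For a family `H = (H_{v⃗})` of subgroups of the container,
"reading (P) over `H`" is `ln ν̄_{𝕃_p}` of the region `v⃗ ↦ hull(⋃_{g ∈ H_{v⃗}} g(M))` — written INLINE below (no definition is introduced):

* `PrimePacket.lnνLp_mono_of_succ`, `PrimePacket.lnνLp_congr_of_succ` — `ln ν̄_{𝕃_p}` is monotone / extensional in the degrees it reads;
* `realPrimePacketWith_pilotRegion_subset_orbitH` ⊆ `…orbitH_subset_slotImages`, `…packetAdm_hull_orbitH` — per summand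
  `M ⊆ ⋃_{g∈H} g(M) ⊆ ⋃_{g∈G₂} g·M`, and the `H`-orbit hull is admissible (trapped between `M` and the container hull);
* **`realPrimePacketWith_lnνLp_pilotRegion_le_hull_orbitH`**, **`realPrimePacketWith_lnνLp_hull_orbitH_le_negLogThetaPerImageAt`** —
  `ln ν̄_{𝕃_p}(O_𝕃(−P_Θ)) ≤ ln ν̄_{𝕃_p}(hull of the H-orbit) ≤ −|log(Θ)|^{(P)}_p`: the per-image number is MONOTONE in the group — a
  SMALLER (Ind2) makes the Θ-side SMALLER, i.e. [IUTchIII] Cor. 3.12 in reading (P) HARDER (F-B28-1 «anti-conservative»);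
* **`realPrimePacketWith_lnνLp_hull_orbitH_eq_of_forall_subset`** — if every `g ∈ H_{v⃗}` maps `M` into `M` (Θ-region-STABILISING
  sub-indeterminacy; e.g. the unit scalars `Im(Ẑ^×) = ℤ_p^×`, `TensorPacketOrbitStable.image_smulOfUnit_smul_normalizedPacket`), the reading over
  `H` IS the bare value `ln ν̄_{𝕃_p}(O_𝕃(−P_Θ)_p) = −deĝ̲_lgp(P_Θ)_p` (Dupuy–Hilado Thm. 3.10.1): ZERO gain — so by `LDHGenuinePerImageZeroGain` a
  per-image Corollary over such an `H` fails at every genuine datum with `log q^{∤2l} ≥ 24`.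

HONEST WORDS: statements about OUR hull functional (`packetHull`) and OUR container; where print's (Ind2) — factorwise `Ism` ([IUTchII]
Ex. 1.8 (iv), Def. 4.9 (i); [IUTchIII] Thm. 3.11 (i)), or the `(Aut(G), Im(Ẑ^×))`-indeterminacy of [IUTchII] Rem. 1.11.3 (ii) — sits
between the stabilisers and the container is READING MATTER for the referees (abc-iut-C-lit 2026-08-27 locator sweep: no printed sentence
fixes the action of `Ism` beyond its definition); nothing here decides it; no side taken; no abc claim. [cite: DupuyHilado2025, §3.9, §4.9,
§4.12, Thm. 3.10.1] [cite: Mochizuki2012, IUTchIII Cor. 3.12 proof Step (x) p. 181; IUTchII Ex. 1.8 (iv) p. 39, Rem. 1.11.3 (ii) p. 52]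
[claim: Mochizuki2012, status: disputed] for every IUT quotation. PROOF-ONLY: no definitions, no new `Prop`.
-/

noncomputable section

open Set Module NumberField IsDedekindDomain
open scoped Pointwise TensorProduct

namespace Literature.IUT.LogVolume

/-! ## 0. `ln ν̄_{𝕃_p}` is monotone and extensional in the degrees `1 ≤ j ≤ ℓ⋆` it reads (any prime packet) -/

namespace PrimePacket

variable {F : Type} [Field F] [NumberField F] {p : ℕ} (Q : PrimePacket F p)

/-- `ln ν̄_{𝕃_p}` is monotone: if in every degree `j = i+1 ≤ ℓ⋆` and collection `v⃗` both regions are admissible and `A ⊆ B`, then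
`ln ν̄_{𝕃_p}(A) ≤ ln ν̄_{𝕃_p}(B)` (weights `Π Pr(v_b) ≥ 0`). [cite: DupuyHilado2025, §3.6, Def. 3.6.3] -/
theorem lnνLp_mono_of_succ (lstar : ℕ) {A B : Q.Region}
    (h : ∀ (i : Fin lstar) (e : Fin ((i : ℕ) + 1 + 1) → placesOver F p),
      Q.adm (A ((i : ℕ) + 1) e) ∧ Q.adm (B ((i : ℕ) + 1) e) ∧ A ((i : ℕ) + 1) e ⊆ B ((i : ℕ) + 1) e) :
    Q.lnνLp lstar A ≤ Q.lnνLp lstar B := by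
  unfold PrimePacket.lnνLp PrimePacket.lnνTensorPower
  refine mul_le_mul_of_nonneg_left (Finset.sum_le_sum fun i _ => Finset.sum_le_sum fun e _ => ?_) (by positivity)
  obtain ⟨hA, hB, hAB⟩ := h i e
  exact mul_le_mul_of_nonneg_right (Q.logμ_mono hA hB hAB) (Finset.prod_nonneg fun b _ => weight_nonneg F _)

/-- `ln ν̄_{𝕃_p}` only reads the degrees `j = i+1 ≤ ℓ⋆`: regions agreeing there have the same `ln ν̄_{𝕃_p}`.
[cite: DupuyHilado2025, Def. 3.6.3] -/
theorem lnνLp_congr_of_succ (lstar : ℕ) {A B : Q.Region}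
    (h : ∀ (i : Fin lstar) (e : Fin ((i : ℕ) + 1 + 1) → placesOver F p), A ((i : ℕ) + 1) e = B ((i : ℕ) + 1) e) :
    Q.lnνLp lstar A = Q.lnνLp lstar B := by
  unfold PrimePacket.lnνLp PrimePacket.lnνTensorPower
  congr 1
  refine Finset.sum_congr rfl fun i _ => Finset.sum_congr rfl fun e _ => ?_
  rw [h i e]

end PrimePacket

/-! ## 1. The real packet: the `H`-orbit of the Θ-region, per summand -/

section RealPacketWith

variable {F : Type} [Field F] [NumberField F]
variable (p : ℕ) [Fact p.Prime] (𝔽 : LocalFields F p)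
variable (c : (j : ℕ) → (Fin (j + 1) → placesOver F p) → ℚ_[p]) (hc0 : ∀ j e, c j e ≠ 0)
  (hcσ : ∀ (j : ℕ) (σ : Equiv.Perm (Fin (j + 1))) (e : Fin (j + 1) → placesOver F p), c j (e ∘ σ) = c j e)

/-- The Θ-region in a degree `j = i+1 ≤ ℓ⋆` IS the translate `ι_j(t_{i,v_j})·(R_I)^∼` (any shell); Literature-level twin of the
summit-side `GenuineContent.realPrimePacketWith_pilotRegion_eq_smul` (`ForkGenuineDepthPerImage`), restated here because a Literature
file cannot import it. [cite: DupuyHilado2025, §3.9] -/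
theorem realPrimePacketWith_pilotRegion_succ_eq {lstar : ℕ} (t : Fin lstar → (v : placesOver F p) → (𝔽.k v)ˣ)
    (i : Fin lstar) (e : Fin ((i : ℕ) + 1 + 1) → placesOver F p) :
    (realPrimePacketWith p 𝔽 c hc0 hcσ).pilotRegion t ((i : ℕ) + 1) e =
      iota p (fun b => 𝔽.k (e b)) (Fin.last _) (t i (e (Fin.last _)) : 𝔽.k (e (Fin.last _))) •
        (normalizedPacket p (fun b => 𝔽.k (e b)) : Set (PacketAlgebra p (fun b => 𝔽.k (e b)))) := by
  rw [PrimePacket.pilotRegion_succ_eq, realPrimePacketWith_peel_image', realPrimePacketWith_O']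

/-- The Θ-region is admissible. [cite: DupuyHilado2025, §3.9] -/
theorem realPrimePacketWith_packetAdm_pilotRegion_succ {lstar : ℕ} (t : Fin lstar → (v : placesOver F p) → (𝔽.k v)ˣ)
    (i : Fin lstar) (e : Fin ((i : ℕ) + 1 + 1) → placesOver F p) :
    PacketAdm p (fun b => 𝔽.k (e b)) ((realPrimePacketWith p 𝔽 c hc0 hcσ).pilotRegion t ((i : ℕ) + 1) e) := by
  rw [realPrimePacketWith_pilotRegion_succ_eq]
  exact packetAdm_iota_smul p (fun b => 𝔽.k (e b)) (Fin.last _) (t i (e (Fin.last _))).ne_zero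
    (packetAdm_normalizedPacket p (fun b => 𝔽.k (e b)))

/-- **`M ⊆ ⋃_{g∈H} g(M)`** (the identity is in `H`). [cite: DupuyHilado2025, §4.9] -/
theorem realPrimePacketWith_pilotRegion_subset_orbitH {lstar : ℕ} (t : Fin lstar → (v : placesOver F p) → (𝔽.k v)ˣ)
    (i : Fin lstar) (e : Fin ((i : ℕ) + 1 + 1) → placesOver F p)
    (H : Subgroup (PacketAlgebra p (fun b => 𝔽.k (e b)) ≃ₗ[ℚ_[p]] PacketAlgebra p (fun b => 𝔽.k (e b)))) :
    (realPrimePacketWith p 𝔽 c hc0 hcσ).pilotRegion t ((i : ℕ) + 1) e ⊆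
      ⋃ g : H, (g : PacketAlgebra p (fun b => 𝔽.k (e b)) ≃ₗ[ℚ_[p]] PacketAlgebra p (fun b => 𝔽.k (e b))) ''
        (realPrimePacketWith p 𝔽 c hc0 hcσ).pilotRegion t ((i : ℕ) + 1) e := by
  intro x hx
  refine Set.mem_iUnion.mpr ⟨(1 : H), ?_⟩
  have h1 : (((1 : H) : PacketAlgebra p (fun b => 𝔽.k (e b)) ≃ₗ[ℚ_[p]] PacketAlgebra p (fun b => 𝔽.k (e b))) :
      PacketAlgebra p (fun b => 𝔽.k (e b)) → PacketAlgebra p (fun b => 𝔽.k (e b))) = id := by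
    rw [OneMemClass.coe_one, LinearEquiv.coe_one]
  rw [h1]
  exact ⟨x, hx, rfl⟩

/-- **`⋃_{g∈H} g(M) ⊆ ⋃_{g∈G₂} g·M`** = the slot images of the SHARP datum (`H ≤ G₂ = indTwo`). [cite: DupuyHilado2025, §4.9] -/
theorem realPrimePacketWith_orbitH_subset_slotImages {lstar : ℕ} (t : Fin lstar → (v : placesOver F p) → (𝔽.k v)ˣ)
    (i : Fin lstar) (e : Fin ((i : ℕ) + 1 + 1) → placesOver F p)
    (H : Subgroup (PacketAlgebra p (fun b => 𝔽.k (e b)) ≃ₗ[ℚ_[p]] PacketAlgebra p (fun b => 𝔽.k (e b))))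
    (hH : H ≤ indTwo p (fun b => 𝔽.k (e b))) :
    (⋃ g : H, (g : PacketAlgebra p (fun b => 𝔽.k (e b)) ≃ₗ[ℚ_[p]] PacketAlgebra p (fun b => 𝔽.k (e b))) ''
        (realPrimePacketWith p 𝔽 c hc0 hcσ).pilotRegion t ((i : ℕ) + 1) e) ⊆
      (realPrimePacketWith p 𝔽 c hc0 hcσ).slotImages ((realPrimePacketWith p 𝔽 c hc0 hcσ).pilotRegion t) ((i : ℕ) + 1) e := by
  rw [realPrimePacketWith_slotImages_pilotRegion_eq, realPrimePacketWith_pilotRegion_succ_eq]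
  refine Set.iUnion_subset fun g => ?_
  intro x hx
  refine Set.mem_iUnion.mpr ⟨⟨(g : _ ≃ₗ[ℚ_[p]] _), hH g.2⟩, ?_⟩
  rw [indTwo_smul_set]
  exact hx

/-- **The `H`-orbit hull is admissible** — trapped between the admissible Θ-region and the admissible container hull
(`realPrimePacketWith_exists_content_logμ_slotImagesHull`). [cite: DupuyHilado2025, §4.12] -/
theorem realPrimePacketWith_packetAdm_hull_orbitH {lstar : ℕ} (t : Fin lstar → (v : placesOver F p) → (𝔽.k v)ˣ)
    (i : Fin lstar) (e : Fin ((i : ℕ) + 1 + 1) → placesOver F p)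
    (H : Subgroup (PacketAlgebra p (fun b => 𝔽.k (e b)) ≃ₗ[ℚ_[p]] PacketAlgebra p (fun b => 𝔽.k (e b))))
    (hH : H ≤ indTwo p (fun b => 𝔽.k (e b))) :
    PacketAdm p (fun b => 𝔽.k (e b))
      (packetHull p (fun b => 𝔽.k (e b))
        (⋃ g : H, (g : PacketAlgebra p (fun b => 𝔽.k (e b)) ≃ₗ[ℚ_[p]] PacketAlgebra p (fun b => 𝔽.k (e b))) ''
          (realPrimePacketWith p 𝔽 c hc0 hcσ).pilotRegion t ((i : ℕ) + 1) e)) := by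
  obtain ⟨m, -, -, hhull, hadm, -⟩ := realPrimePacketWith_exists_content_logμ_slotImagesHull p 𝔽 c hc0 hcσ t i e
  refine packetAdm_of_subset_of_subset p (fun b => 𝔽.k (e b))
    (realPrimePacketWith_packetAdm_pilotRegion_succ p 𝔽 c hc0 hcσ t i e) hadm ?_ ?_
  · exact (realPrimePacketWith_pilotRegion_subset_orbitH p 𝔽 c hc0 hcσ t i e H).trans (subset_packetHull p _ _)
  · exact packetHull_mono p _ (realPrimePacketWith_orbitH_subset_slotImages p 𝔽 c hc0 hcσ t i e H hH)

/-! ## 2. Monotonicity: bare ≤ reading over `H` ≤ reading over the container -/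

/-- **`ln ν̄_{𝕃_p}(O_𝕃(−P_Θ)) ≤ ln ν̄_{𝕃_p}(hull of the H-orbit)`**: the reading over ANY sub-indeterminacy is at least the bare pilot
volume (the free inequality of `LDHGenuinePerImageShallow`, for every `H`). [cite: DupuyHilado2025, §4.12]
[cite: Mochizuki2012, IUTchIII Cor. 3.12 proof Step (x) p. 181] [claim: Mochizuki2012, status: disputed] -/
theorem realPrimePacketWith_lnνLp_pilotRegion_le_hull_orbitH {lstar : ℕ} (t : Fin lstar → (v : placesOver F p) → (𝔽.k v)ˣ)
    (H : (j : ℕ) → (e : Fin (j + 1) → placesOver F p) →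
      Subgroup (PacketAlgebra p (fun b => 𝔽.k (e b)) ≃ₗ[ℚ_[p]] PacketAlgebra p (fun b => 𝔽.k (e b))))
    (hH : ∀ j e, H j e ≤ indTwo p (fun b => 𝔽.k (e b))) :
    (realPrimePacketWith p 𝔽 c hc0 hcσ).lnνLp lstar ((realPrimePacketWith p 𝔽 c hc0 hcσ).pilotRegion t) ≤
      (realPrimePacketWith p 𝔽 c hc0 hcσ).lnνLp lstar (fun j e =>
        packetHull p (fun b => 𝔽.k (e b))
          (⋃ g : H j e, (g : PacketAlgebra p (fun b => 𝔽.k (e b)) ≃ₗ[ℚ_[p]] PacketAlgebra p (fun b => 𝔽.k (e b))) ''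
            (realPrimePacketWith p 𝔽 c hc0 hcσ).pilotRegion t j e)) := by
  refine (realPrimePacketWith p 𝔽 c hc0 hcσ).lnνLp_mono_of_succ lstar fun i e => ⟨?_, ?_, ?_⟩
  · exact realPrimePacketWith_packetAdm_pilotRegion_succ p 𝔽 c hc0 hcσ t i e
  · exact realPrimePacketWith_packetAdm_hull_orbitH p 𝔽 c hc0 hcσ t i e (H _ e) (hH _ e)
  · exact (realPrimePacketWith_pilotRegion_subset_orbitH p 𝔽 c hc0 hcσ t i e (H _ e)).trans (subset_packetHull p _ _)

/-- **`ln ν̄_{𝕃_p}(hull of the H-orbit) ≤ −|log(Θ)|^{(P)}_p`** (the container reading): `−|log(Θ)|_(P)` is MONOTONE in the (Ind2)-group —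
a per-image reading over a SMALLER indeterminacy has a SMALLER Θ-side, so [IUTchIII] Cor. 3.12 (P) over it is HARDER (referee finding
F-B28-1: the container is anti-conservative for per-image readings). [cite: DupuyHilado2025, §4.9, §4.12]
[cite: Mochizuki2012, IUTchIII Cor. 3.12 proof Step (x) p. 181] [claim: Mochizuki2012, status: disputed] -/
theorem realPrimePacketWith_lnνLp_hull_orbitH_le_negLogThetaPerImageAt {lstar : ℕ}
    (t : Fin lstar → (v : placesOver F p) → (𝔽.k v)ˣ)
    (H : (j : ℕ) → (e : Fin (j + 1) → placesOver F p) →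
      Subgroup (PacketAlgebra p (fun b => 𝔽.k (e b)) ≃ₗ[ℚ_[p]] PacketAlgebra p (fun b => 𝔽.k (e b))))
    (hH : ∀ j e, H j e ≤ indTwo p (fun b => 𝔽.k (e b))) :
    (realPrimePacketWith p 𝔽 c hc0 hcσ).lnνLp lstar (fun j e =>
        packetHull p (fun b => 𝔽.k (e b))
          (⋃ g : H j e, (g : PacketAlgebra p (fun b => 𝔽.k (e b)) ≃ₗ[ℚ_[p]] PacketAlgebra p (fun b => 𝔽.k (e b))) ''
            (realPrimePacketWith p 𝔽 c hc0 hcσ).pilotRegion t j e)) ≤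
      (realPrimePacketWith p 𝔽 c hc0 hcσ).negLogThetaPerImageAt lstar t := by
  unfold PrimePacket.negLogThetaPerImageAt
  refine (realPrimePacketWith p 𝔽 c hc0 hcσ).lnνLp_mono_of_succ lstar fun i e => ⟨?_, ?_, ?_⟩
  · exact realPrimePacketWith_packetAdm_hull_orbitH p 𝔽 c hc0 hcσ t i e (H _ e) (hH _ e)
  · obtain ⟨m, -, -, -, hadm, -⟩ := realPrimePacketWith_exists_content_logμ_slotImagesHull p 𝔽 c hc0 hcσ t i e
    exact hadm
  · exact packetHull_mono p _ (realPrimePacketWith_orbitH_subset_slotImages p 𝔽 c hc0 hcσ t i e (H _ e) (hH _ e))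

/-! ## 3. Stabilising sub-indeterminacies: the reading IS the bare value (zero gain) -/

/-- **ZERO GAIN**: if in every degree `j = i+1 ≤ ℓ⋆` and collection `v⃗` every `g ∈ H_{v⃗}` maps the Θ-region `ι_j(t_{i,v_j})·(R_I)^∼` into
itself, then `ln ν̄_{𝕃_p}(hull of the H-orbit) = ln ν̄_{𝕃_p}(O_𝕃(−P_Θ))`, the BARE pilot volume (`= −deĝ̲_lgp(P_Θ)_p`, Dupuy–Hilado Thm. 3.10.1)
— e.g. for every subgroup of unit homotheties `ℤ_p^× = Im(Ẑ^×)` (`TensorPacketOrbitStable.image_smulOfUnit_smul_normalizedPacket`).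
[cite: DupuyHilado2025, §4.12, Thm. 3.10.1] [cite: Mochizuki2012, IUTchII Ex. 1.8 (iv) p. 39] [claim: Mochizuki2012, status: disputed] -/
theorem realPrimePacketWith_lnνLp_hull_orbitH_eq_of_forall_subset {lstar : ℕ}
    (t : Fin lstar → (v : placesOver F p) → (𝔽.k v)ˣ)
    (H : (j : ℕ) → (e : Fin (j + 1) → placesOver F p) →
      Subgroup (PacketAlgebra p (fun b => 𝔽.k (e b)) ≃ₗ[ℚ_[p]] PacketAlgebra p (fun b => 𝔽.k (e b))))
    (hstab : ∀ (i : Fin lstar) (e : Fin ((i : ℕ) + 1 + 1) → placesOver F p), ∀ g ∈ H ((i : ℕ) + 1) e,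
      (g : PacketAlgebra p (fun b => 𝔽.k (e b)) ≃ₗ[ℚ_[p]] PacketAlgebra p (fun b => 𝔽.k (e b))) ''
          (iota p (fun b => 𝔽.k (e b)) (Fin.last _) (t i (e (Fin.last _)) : 𝔽.k (e (Fin.last _))) •
            (normalizedPacket p (fun b => 𝔽.k (e b)) : Set (PacketAlgebra p (fun b => 𝔽.k (e b))))) ⊆
        iota p (fun b => 𝔽.k (e b)) (Fin.last _) (t i (e (Fin.last _)) : 𝔽.k (e (Fin.last _))) •
          (normalizedPacket p (fun b => 𝔽.k (e b)) : Set (PacketAlgebra p (fun b => 𝔽.k (e b))))) :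
    (realPrimePacketWith p 𝔽 c hc0 hcσ).lnνLp lstar (fun j e =>
        packetHull p (fun b => 𝔽.k (e b))
          (⋃ g : H j e, (g : PacketAlgebra p (fun b => 𝔽.k (e b)) ≃ₗ[ℚ_[p]] PacketAlgebra p (fun b => 𝔽.k (e b))) ''
            (realPrimePacketWith p 𝔽 c hc0 hcσ).pilotRegion t j e)) =
      (realPrimePacketWith p 𝔽 c hc0 hcσ).lnνLp lstar ((realPrimePacketWith p 𝔽 c hc0 hcσ).pilotRegion t) := by
  refine (realPrimePacketWith p 𝔽 c hc0 hcσ).lnνLp_congr_of_succ lstar fun i e => ?_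
  show packetHull p (fun b => 𝔽.k (e b)) _ = _
  rw [realPrimePacketWith_pilotRegion_succ_eq]
  exact packetHull_iUnion_coe_image_eq_of_forall_subset p (fun b => 𝔽.k (e b))
    (packetHull_smul_normalizedPacket p (fun b => 𝔽.k (e b)) _) (H _ e) (hstab i e)

/-- **ZERO GAIN OVER THE UNIT SCALARS**: for any family of subgroups of unit homotheties (`g(x) = u·x`, `‖u‖ = 1` — [IUTchII] Ex. 1.8 (iv)'s
`Im(Ẑ^×)`, inside the container by `smulOfUnit_mem_indTwo`), the per-image reading IS the bare pilot volume. [cite: DupuyHilado2025, §4.12]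
[cite: Mochizuki2012, IUTchII Ex. 1.8 (iv) p. 39] [claim: Mochizuki2012, status: disputed] -/
theorem realPrimePacketWith_lnνLp_hull_orbitH_eq_of_forall_eq_smul {lstar : ℕ}
    (t : Fin lstar → (v : placesOver F p) → (𝔽.k v)ˣ)
    (H : (j : ℕ) → (e : Fin (j + 1) → placesOver F p) →
      Subgroup (PacketAlgebra p (fun b => 𝔽.k (e b)) ≃ₗ[ℚ_[p]] PacketAlgebra p (fun b => 𝔽.k (e b))))
    (hH : ∀ j e, ∀ g ∈ H j e, ∃ u : ℚ_[p], ‖u‖ = 1 ∧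
      ∀ x, (g : PacketAlgebra p (fun b => 𝔽.k (e b)) ≃ₗ[ℚ_[p]] PacketAlgebra p (fun b => 𝔽.k (e b))) x = u • x) :
    (realPrimePacketWith p 𝔽 c hc0 hcσ).lnνLp lstar (fun j e =>
        packetHull p (fun b => 𝔽.k (e b))
          (⋃ g : H j e, (g : PacketAlgebra p (fun b => 𝔽.k (e b)) ≃ₗ[ℚ_[p]] PacketAlgebra p (fun b => 𝔽.k (e b))) ''
            (realPrimePacketWith p 𝔽 c hc0 hcσ).pilotRegion t j e)) =
      (realPrimePacketWith p 𝔽 c hc0 hcσ).lnνLp lstar ((realPrimePacketWith p 𝔽 c hc0 hcσ).pilotRegion t) := by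
  refine (realPrimePacketWith p 𝔽 c hc0 hcσ).lnνLp_congr_of_succ lstar fun i e => ?_
  show packetHull p (fun b => 𝔽.k (e b)) _ = _
  rw [realPrimePacketWith_pilotRegion_succ_eq]
  exact packetHull_iUnion_image_eq_of_forall_eq_smul p (fun b => 𝔽.k (e b)) (H _ e) (hH _ e) _

end RealPacketWith

end Literature.IUT.LogVolume

end
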